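import Literature.AlgebraicGeometry.Frobenioids.Prop25Sub
import HarnessLib

/-!
# [FrdI] Proposition 2.5 (iii), sub-DAG row P25-L02 — uniqueness of the four-fold factorisation:
# discharge of `FrdI.P25.FourFoldFactorisationUnique`

Mochizuki, *The geometry of Frobenioids I: the general theory*, Kyushu J. Math. **62** (2008)
293–400, §2, proof of Proposition 2.5 (iii), p. 49 ll. 26–29 [cite: MochizukiFrdI2008, Prop. 2.5(iii) p.49]:
"this factorization is unique [cf. Definition 1.3, (iv), (a); (v), (c)], up to replacing `(α, β, γ, δ)`
by `(α ∘ ε, ε⁻¹ ∘ β ∘ ζ, ζ⁻¹ ∘ γ ∘ θ, θ⁻¹ ∘ δ)`, where `ε, θ` are isomorphisms of `C`, and `ζ = β′ ∘ ε`,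
for some base-identity automorphism `β′`."
PROOF-ONLY companion of `Prop25Sub.lean` (row P25-L02, holder/typer abc-iut-L1-t2): Def. 1.3 (iv)(a)
uniqueness (`hF.iv_a_unique`, applied to `δ ≫ (γ ≫ β) ≫ α`) and Def. 1.3 (v)(c) uniqueness
(`hF.v_c_unique`, applied to the pre-step `γ ≫ β ≫ δ₁`); the base-identity automorphism `β′` is the
discrepancy between the two comparison isomorphisms at the middle object.  No new definitions.
-/

namespace Literature.AlgebraicGeometry.Frobenioids

open CategoryTheory Opposite

namespace FrdI.P25

open PreFrobenioid

universe w v v' u u'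

variable {D : Type u} [Category.{v} D] {Φ : Dᵒᵖ ⥤ CommMonCat.{w}}
  {C : Type u'} [Category.{v'} C] {F : C ⥤ ElemFrobenioid Φ}

/-- **Row P25-L02 `FourFoldFactorisationUnique` DISCHARGED**. [cite: MochizukiFrdI2008, Prop. 2.5(iii) p.49] -/
theorem fourFoldFactorisationUnique_holds : FourFoldFactorisationUnique F := by
  intro hS A B X Y X' Y' φ δ γ β α δ' γ' β' α' h₁ h₂
  have hF := hS.isFrobenioid
  have hP := hF.isPreFrobenioid
  have hC := hP.isTotallyEpimorphic
  obtain ⟨hδ, ⟨hγi, hγp⟩, hβ, hα, hfac⟩ := h₁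
  obtain ⟨hδ', ⟨hγ'i, hγ'p⟩, hβ', hα', hfac'⟩ := h₂
  -- `γ ≫ β` and `γ' ≫ β'` are pre-steps
  have hβp : IsPreStep F β := isPreStep_of_mem_endSubmonoid F ⟨β, hβ⟩
  have hβ'p : IsPreStep F β' := isPreStep_of_mem_endSubmonoid F ⟨β', hβ'⟩
  have hm : IsPreStep F (γ ≫ β) := IsPreStep.comp F hγp hβp
  have hm' : IsPreStep F (γ' ≫ β') := IsPreStep.comp F hγ'p hβ'p
  -- Def. 1.3 (iv)(a), uniqueness
  obtain ⟨ε₁, δ₁, he₁, hmid, hα₁⟩ := hF.iv_a_unique φ δ (γ ≫ β) α δ' (γ' ≫ β') α'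
    (by simpa only [Category.assoc] using hfac) hδ hm hα
    (by simpa only [Category.assoc] using hfac') hδ' hm' hα'
  -- Def. 1.3 (v)(c), uniqueness, for the pre-step `γ ≫ β ≫ δ₁ : X ⟶ Y'`
  have hcoβ : IsCoAngularPreStep F (β ≫ δ₁.hom) :=
    ⟨IsCoAngular.comp F hF (isCoAngular_endo F hF β) (isCoAngular_of_isIso F hC δ₁.hom),
      IsPreStep.comp F hβp (isPreStep_of_isIso F δ₁.hom)⟩
  have hcoβ' : IsCoAngularPreStep F β' := ⟨isCoAngular_endo F hF β', hβ'p⟩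
  have hiso' : IsIsometry F (ε₁.hom ≫ γ') ∧ IsPreStep F (ε₁.hom ≫ γ') :=
    ⟨IsIsometry.comp F (isIsometry_of_isIso F hP ε₁.hom) hγ'i,
      IsPreStep.comp F (isPreStep_of_isIso F ε₁.hom) hγ'p⟩
  obtain ⟨g, hg₁, hg₂⟩ := hF.v_c_unique (γ ≫ β ≫ δ₁.hom) γ (β ≫ δ₁.hom) (ε₁.hom ≫ γ') β' rfl
    ⟨hγi, hγp⟩ hcoβ (by rw [Category.assoc, ← hmid, Category.assoc]) hiso' hcoβ'
  -- the base-identity automorphism `u := g⁻¹ ∘ δ₁` of `Y` (print's `β′`)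
  let u : Aut Y := δ₁ ≪≫ g.symm
  have hu : u ∈ unitsSubgroup F Y := by
    refine ⟨?_, isLinear_of_isIso F u.hom⟩
    show Base F (δ₁.hom ≫ g.inv) = 𝟙 _
    have e := congrArg (Base F) hg₂
    rw [base_comp, base_comp, show Base F β = 𝟙 _ from hβ.1, show Base F β' = 𝟙 _ from hβ'.1,
      Category.id_comp, Category.comp_id] at e
    -- e : Base δ₁.hom = Base g.hom
    rw [base_comp, e, ← base_comp, g.hom_inv_id, base_id]
  refine ⟨ε₁.symm, δ₁.symm, u, hu, ?_, ?_, ?_, ?_⟩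
  · -- δ' = δ ≫ θ⁻¹
    show δ' = δ ≫ ε₁.hom
    exact he₁.symm
  · -- γ' = θ ≫ γ ≫ u⁻¹ ≫ ε⁻¹
    show γ' = ε₁.inv ≫ γ ≫ (g.hom ≫ δ₁.inv) ≫ δ₁.hom
    simp only [Category.assoc, Iso.inv_hom_id, Category.comp_id]
    rw [hg₁, Iso.inv_hom_id_assoc]
  · -- β' = (ε ≫ u) ≫ β ≫ ε⁻¹
    show β' = (δ₁.inv ≫ δ₁.hom ≫ g.inv) ≫ β ≫ δ₁.hom
    simp only [Iso.inv_hom_id_assoc]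
    rw [hg₂, Iso.inv_hom_id_assoc]
  · -- α' = ε ≫ α
    show α' = δ₁.inv ≫ α
    rw [hα₁, Iso.inv_hom_id_assoc]

/-- `FourFoldFactorisationUnique` — `_holds` alias of `fourFoldFactorisationUnique_holds` above under the fact's exact name (appended
2026-08-28, D-0026 bookkeeping: the proof term is the existing theorem of this file; no statement,
definition or attribute is edited; no new named fact; the ledger's debt table listed the fact
unproved). [cite: MochizukiFrdI2008, Prop. 2.5(iii) p.49] -/
theorem _root_.Literature.AlgebraicGeometry.Frobenioids.FrdI.P25.FourFoldFactorisationUnique_holds :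
    FourFoldFactorisationUnique F :=
  _root_.Literature.AlgebraicGeometry.Frobenioids.FrdI.P25.fourFoldFactorisationUnique_holds (F := F)

end FrdI.P25

end Literature.AlgebraicGeometry.Frobenioids
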